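import Mathlib
import Literature.Analysis.OperatorTheory.KernelEnergyMomentumPair
import HarnessLib

/-!
# The complex conjugation of a kernel Hilbert space with real Gram matrix

Setting: a complex Hilbert space `H` with kernel vectors `δ : X → H` of dense span
(`KernelEnergyMomentumPair`) whose Gram matrix `⟪δₓ, δᵧ⟫` is REAL — the situation of the
Osterwalder–Schrader reconstruction from real (Euclidean) correlation functions, where `H` is the
complexification of a real Hilbert space (Glimm–Jaffe, *Quantum Physics* (1987), §6.1; Osterwalder–
Schrader, CMP 31 (1973), §4.1). We construct the **complex conjugation** `J` (`conjOp δ`), the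
antiunitary involution fixing the kernel vectors, `J (Σ cₓ δₓ) = Σ conj cₓ δₓ`, and the continuous
complex-BILINEAR **pairing** `β(φ, ψ) = ⟪J φ, ψ⟫` (`pairing δ`), the tool that turns norms of
holomorphic vector families into holomorphic functions: `‖φ‖² = β(J φ, φ)`.

## Contents (namespace `Literature.Analysis.OperatorTheory.KernelVectors`; all proved)

* `conjOp δ : H →L[ℝ] H` (extension by `LinearMap.extendOfNorm` of coefficientwise conjugation),
  `conjOp_lc`, `conjOp_gen` (`J δₓ = δₓ`), `inner_conjOp_conjOp` (`⟪Jφ, Jψ⟫ = ⟪ψ, φ⟫`),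
  `conjOp_conjOp` (`J² = 1`), `conjOp_smul` (antilinearity), `norm_conjOp`.
* `conjOp_clm_apply`: an operator `T'` with matrix `conj` of the matrix of `T` satisfies `J T = T' J`;
  `conjOp_clm_apply_of_real`: operators with real matrix commute with `J`.
* `pairing δ : H →L[ℂ] H →L[ℂ] ℂ`, `pairing_apply` (`= ⟪J φ, ψ⟫`), `pairing_gen_left`,
  `inner_self_eq_pairing` (`⟪φ, φ⟫ = β(Jφ, φ)`), `norm_pairing_le`, and `DifferentiableAt.pairing`
  (pairings of holomorphic vector families are holomorphic).

## References
* J. Glimm, A. Jaffe, *Quantum Physics* (2nd ed. 1987), §6.1.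
* K. Osterwalder, R. Schrader, Axioms for Euclidean Green's functions, CMP 31 (1973), §4.1.
-/

noncomputable section

open Filter ComplexConjugate
open scoped InnerProductSpace Topology

namespace Literature.Analysis.OperatorTheory

namespace KernelVectors

variable {X : Type*} {H : Type*} [NormedAddCommGroup H] [InnerProductSpace ℂ H]

/-! ## Conjugate coefficient vectors -/

/-- Real Gram entries are symmetric: `⟪δᵧ, δₓ⟫ = ⟪δₓ, δᵧ⟫`. [folklore] -/
theorem inner_gen_comm (δ : X → H) (hreal : ∀ x y, (⟪δ x, δ y⟫_ℂ).im = 0) (x y : X) :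
    ⟪δ y, δ x⟫_ℂ = ⟪δ x, δ y⟫_ℂ := by
  rw [← inner_conj_symm]
  exact Complex.conj_eq_iff_im.2 (hreal x y)

/-- Real Gram entries are fixed by conjugation. [folklore] -/
theorem conj_inner_gen (δ : X → H) (hreal : ∀ x y, (⟪δ x, δ y⟫_ℂ).im = 0) (x y : X) :
    conj ⟪δ x, δ y⟫_ℂ = ⟪δ x, δ y⟫_ℂ :=
  Complex.conj_eq_iff_im.2 (hreal x y)

/-- Gram identity for conjugate coefficient vectors:
`⟪Σ conj cₓ δₓ, Σ conj c'ᵧ δᵧ⟫ = ⟪Σ c'ᵧ δᵧ, Σ cₓ δₓ⟫` (real Gram matrix). [folklore] -/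
theorem inner_lc_mapRange_conj (δ : X → H) (hreal : ∀ x y, (⟪δ x, δ y⟫_ℂ).im = 0) (c c' : X →₀ ℂ) :
    ⟪Finsupp.linearCombination ℂ δ (Finsupp.mapRange conj (map_zero _) c),
      Finsupp.linearCombination ℂ δ (Finsupp.mapRange conj (map_zero _) c')⟫_ℂ =
      ⟪Finsupp.linearCombination ℂ δ c', Finsupp.linearCombination ℂ δ c⟫_ℂ := by
  classical
  rw [inner_lc_lc, inner_lc_lc,
    Finsupp.support_mapRange_of_injective _ c (starRingEnd ℂ).injective,
    Finsupp.support_mapRange_of_injective _ c' (starRingEnd ℂ).injective, Finset.sum_comm]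
  refine Finset.sum_congr rfl fun y _ => Finset.sum_congr rfl fun x _ => ?_
  rw [Finsupp.mapRange_apply, Finsupp.mapRange_apply, Complex.conj_conj, inner_gen_comm δ hreal y x]
  ring

/-- Conjugating the coefficients preserves the norm of a combination (real Gram matrix). [folklore] -/
theorem norm_lc_mapRange_conj (δ : X → H) (hreal : ∀ x y, (⟪δ x, δ y⟫_ℂ).im = 0) (c : X →₀ ℂ) :
    ‖Finsupp.linearCombination ℂ δ (Finsupp.mapRange conj (map_zero _) c)‖ =
      ‖Finsupp.linearCombination ℂ δ c‖ := by
  rw [@norm_eq_sqrt_re_inner ℂ, @norm_eq_sqrt_re_inner ℂ, inner_lc_mapRange_conj δ hreal]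

/-! ## The conjugation `J` -/

/-- The coefficientwise conjugation `c ↦ Σ conj cₓ δₓ` as a real-linear map on coefficient vectors. [folklore] -/
def preConj (δ : X → H) : (X →₀ ℂ) →ₗ[ℝ] H :=
  (Finsupp.linearCombination ℂ δ).restrictScalars ℝ ∘ₗ
    Finsupp.mapRange.linearMap (Complex.conjAe.toLinearMap : ℂ →ₗ[ℝ] ℂ)

/-- `preConj δ c = Σ conj cₓ δₓ`. [folklore] -/
theorem preConj_apply (δ : X → H) (c : X →₀ ℂ) :
    preConj δ c = Finsupp.linearCombination ℂ δ (Finsupp.mapRange conj (map_zero _) c) := by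
  simp only [preConj, LinearMap.comp_apply, LinearMap.coe_restrictScalars,
    Finsupp.mapRange.linearMap_apply]
  rfl

/-- **The complex conjugation `J` of the kernel Hilbert space** (antiunitary involution fixing the
kernel vectors; the complex conjugation of the complexified real OS space, Glimm–Jaffe §6.1): the
extension by continuity of `Σ cₓ δₓ ↦ Σ conj cₓ δₓ`, a real-linear bounded map. Its properties need
the dense span and the reality of the Gram matrix and are stated separately. [cite: GlimmJaffe1987, §6.1] -/
def conjOp (δ : X → H) [CompleteSpace H] : H →L[ℝ] H :=
  (preConj δ).extendOfNorm ((Finsupp.linearCombination ℂ δ).restrictScalars ℝ)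

section Conj

variable [CompleteSpace H] (δ : X → H) (hδ : DenseRange (Finsupp.linearCombination ℂ δ))
  (hreal : ∀ x y, (⟪δ x, δ y⟫_ℂ).im = 0)

include hδ hreal

/-- `J (Σ cₓ δₓ) = Σ conj cₓ δₓ`. [folklore] -/
theorem conjOp_lc (c : X →₀ ℂ) :
    conjOp δ (Finsupp.linearCombination ℂ δ c) =
      Finsupp.linearCombination ℂ δ (Finsupp.mapRange conj (map_zero _) c) := by
  have hd : DenseRange ((Finsupp.linearCombination ℂ δ).restrictScalars ℝ) := hδ
  have hb : ∃ C, ∀ c : X →₀ ℂ, ‖preConj δ c‖ ≤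
      C * ‖(Finsupp.linearCombination ℂ δ).restrictScalars ℝ c‖ :=
    ⟨1, fun c => by rw [preConj_apply, norm_lc_mapRange_conj δ hreal, one_mul]; rfl⟩
  have := LinearMap.extendOfNorm_eq hd hb c
  rw [conjOp]
  exact this.trans (preConj_apply δ c)

/-- **`J` fixes the kernel vectors**: `J δₓ = δₓ`. [folklore] -/
theorem conjOp_gen (x : X) : conjOp δ (δ x) = δ x := by
  rw [← lc_single δ x, conjOp_lc δ hδ hreal, Finsupp.mapRange_single, map_one]

/-- **`J` is antiunitary**: `⟪J φ, J ψ⟫ = ⟪ψ, φ⟫`. [folklore] -/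
theorem inner_conjOp_conjOp (φ ψ : H) : ⟪conjOp δ φ, conjOp δ ψ⟫_ℂ = ⟪ψ, φ⟫_ℂ := by
  refine hδ.induction_on φ ?_ fun c => ?_
  · exact isClosed_eq ((conjOp δ).continuous.inner continuous_const) (continuous_const.inner continuous_id)
  · refine hδ.induction_on ψ ?_ fun c' => ?_
    · exact isClosed_eq (continuous_const.inner (conjOp δ).continuous) (continuous_id.inner continuous_const)
    · rw [conjOp_lc δ hδ hreal, conjOp_lc δ hδ hreal, inner_lc_mapRange_conj δ hreal]

/-- `J` is isometric. [folklore] -/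
theorem norm_conjOp (φ : H) : ‖conjOp δ φ‖ = ‖φ‖ := by
  rw [@norm_eq_sqrt_re_inner ℂ, @norm_eq_sqrt_re_inner ℂ, inner_conjOp_conjOp δ hδ hreal]

/-- **`J` is an involution**: `J (J φ) = φ`. [folklore] -/
theorem conjOp_conjOp (φ : H) : conjOp δ (conjOp δ φ) = φ := by
  refine hδ.induction_on φ ?_ fun c => ?_
  · exact isClosed_eq ((conjOp δ).continuous.comp (conjOp δ).continuous) continuous_id
  · rw [conjOp_lc δ hδ hreal, conjOp_lc δ hδ hreal]
    congr 1
    ext x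
    simp

/-- **`J` is conjugate-linear**: `J (a • φ) = conj a • J φ`. [folklore] -/
theorem conjOp_smul (a : ℂ) (φ : H) : conjOp δ (a • φ) = conj a • conjOp δ φ := by
  refine hδ.induction_on φ ?_ fun c => ?_
  · exact isClosed_eq ((conjOp δ).continuous.comp (continuous_const_smul a))
      ((continuous_const_smul _).comp (conjOp δ).continuous)
  · rw [← map_smul, conjOp_lc δ hδ hreal, conjOp_lc δ hδ hreal, ← map_smul]
    congr 1
    ext x
    simp

/-- `⟪φ, J ψ⟫ = ⟪ψ, J φ⟫`. [folklore] -/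
theorem inner_conjOp_right (φ ψ : H) : ⟪φ, conjOp δ ψ⟫_ℂ = ⟪ψ, conjOp δ φ⟫_ℂ := by
  conv_lhs => rw [← conjOp_conjOp δ hδ hreal φ]
  rw [inner_conjOp_conjOp δ hδ hreal]

/-- **Intertwining from conjugate matrices**: if `⟪δₓ, T' δᵧ⟫ = conj ⟪δₓ, T δᵧ⟫` for all kernel
vectors then `J (T φ) = T' (J φ)`. [folklore] -/
theorem conjOp_clm_apply {T T' : H →L[ℂ] H}
    (h : ∀ x y, ⟪δ x, T' (δ y)⟫_ℂ = conj ⟪δ x, T (δ y)⟫_ℂ) (φ : H) :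
    conjOp δ (T φ) = T' (conjOp δ φ) := by
  have hgen : ∀ y, conjOp δ (T (δ y)) = T' (δ y) := by
    intro y
    refine ext_inner_gen' δ hδ fun x => ?_
    rw [h x y, ← conjOp_gen δ hδ hreal x, inner_conjOp_conjOp δ hδ hreal, conjOp_gen δ hδ hreal,
      inner_conj_symm]
  refine hδ.induction_on φ ?_ fun c => ?_
  · exact isClosed_eq ((conjOp δ).continuous.comp T.continuous) (T'.continuous.comp (conjOp δ).continuous)
  · rw [conjOp_lc δ hδ hreal, Finsupp.linearCombination_apply, Finsupp.linearCombination_apply,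
      Finsupp.sum_mapRange_index (fun x => by simp), Finsupp.sum, Finsupp.sum, map_sum, map_sum, map_sum]
    refine Finset.sum_congr rfl fun y _ => ?_
    rw [map_smul, conjOp_smul δ hδ hreal, hgen, map_smul]
where
  /-- (local restatement of `ext_inner_gen` to keep this file independent of `KernelMatrixOperators`) -/
  ext_inner_gen' (δ : X → H) (hδ : DenseRange (Finsupp.linearCombination ℂ δ)) {v w : H}
      (h : ∀ x, ⟪δ x, v⟫_ℂ = ⟪δ x, w⟫_ℂ) : v = w := by
    have key : ∀ c : X →₀ ℂ,
        ⟪Finsupp.linearCombination ℂ δ c, v⟫_ℂ = ⟪Finsupp.linearCombination ℂ δ c, w⟫_ℂ := by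
      intro c
      rw [Finsupp.linearCombination_apply, Finsupp.sum, sum_inner, sum_inner]
      refine Finset.sum_congr rfl fun x _ => ?_
      rw [inner_smul_left, inner_smul_left, h x]
    exact ext_inner_left ℂ fun φ => hδ.induction_on φ
      (isClosed_eq (continuous_id.inner continuous_const) (continuous_id.inner continuous_const)) key

/-- **Operators with real matrix commute with `J`.** [folklore] -/
theorem conjOp_clm_apply_of_real {T : H →L[ℂ] H} (h : ∀ x y, (⟪δ x, T (δ y)⟫_ℂ).im = 0) (φ : H) :
    conjOp δ (T φ) = T (conjOp δ φ) :=
  conjOp_clm_apply δ hδ hreal (fun x y => (Complex.conj_eq_iff_im.2 (h x y)).symm) φ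

end Conj

/-! ## The bilinear pairing `β(φ, ψ) = ⟪J φ, ψ⟫` -/

/-- **The complex-bilinear pairing** `β(φ, ψ) = ⟪J φ, ψ⟫` of the kernel Hilbert space (linear in
BOTH variables since `J` is antilinear and `⟪·, ·⟫` is antilinear in its first slot); on kernel
vectors it is the Gram matrix, `β(δₓ, δᵧ) = ⟪δₓ, δᵧ⟫`. [folklore] -/
def pairing (δ : X → H) [CompleteSpace H] (hδ : DenseRange (Finsupp.linearCombination ℂ δ))
    (hreal : ∀ x y, (⟪δ x, δ y⟫_ℂ).im = 0) : H →L[ℂ] H →L[ℂ] ℂ :=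
  LinearMap.mkContinuous₂
    (LinearMap.mk₂ ℂ (fun φ ψ => ⟪conjOp δ φ, ψ⟫_ℂ)
      (fun φ φ' ψ => by rw [map_add, inner_add_left])
      (fun a φ ψ => by rw [conjOp_smul δ hδ hreal, inner_smul_left, Complex.conj_conj, smul_eq_mul])
      (fun φ ψ ψ' => inner_add_right _ _ _)
      (fun a φ ψ => by rw [inner_smul_right, smul_eq_mul]))
    1 (fun φ ψ => by
      rw [LinearMap.mk₂_apply, one_mul, ← norm_conjOp δ hδ hreal φ]
      exact norm_inner_le_norm _ _)

section Pairing

variable [CompleteSpace H] (δ : X → H) (hδ : DenseRange (Finsupp.linearCombination ℂ δ))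
  (hreal : ∀ x y, (⟪δ x, δ y⟫_ℂ).im = 0)

/-- `β(φ, ψ) = ⟪J φ, ψ⟫`. [folklore] -/
@[simp] theorem pairing_apply (φ ψ : H) : pairing δ hδ hreal φ ψ = ⟪conjOp δ φ, ψ⟫_ℂ := rfl

/-- `β(δₓ, ψ) = ⟪δₓ, ψ⟫`. [folklore] -/
theorem pairing_gen_left (x : X) (ψ : H) : pairing δ hδ hreal (δ x) ψ = ⟪δ x, ψ⟫_ℂ := by
  rw [pairing_apply, conjOp_gen δ hδ hreal]

/-- **`⟪φ, φ⟫ = β(J φ, φ)`**: the norm through the bilinear pairing. [folklore] -/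
theorem inner_self_eq_pairing (φ : H) : ⟪φ, φ⟫_ℂ = pairing δ hδ hreal (conjOp δ φ) φ := by
  rw [pairing_apply, conjOp_conjOp δ hδ hreal]

/-- `‖φ‖² = Re β(J φ, φ)`. [folklore] -/
theorem norm_sq_eq_re_pairing (φ : H) : ‖φ‖ ^ 2 = (pairing δ hδ hreal (conjOp δ φ) φ).re := by
  rw [← inner_self_eq_pairing, ← RCLike.re_to_complex, inner_self_eq_norm_sq (𝕜 := ℂ)]

/-- `‖β(φ, ψ)‖ ≤ ‖φ‖ ‖ψ‖`. [folklore] -/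
theorem norm_pairing_le (φ ψ : H) : ‖pairing δ hδ hreal φ ψ‖ ≤ ‖φ‖ * ‖ψ‖ := by
  rw [pairing_apply, ← norm_conjOp δ hδ hreal φ]
  exact norm_inner_le_norm _ _

/-- **Pairings of holomorphic vector families are holomorphic.** [folklore] -/
theorem _root_.DifferentiableAt.kernelPairing {V W : ℂ → H} {z : ℂ} (hV : DifferentiableAt ℂ V z)
    (hW : DifferentiableAt ℂ W z) :
    DifferentiableAt ℂ (fun w => pairing δ hδ hreal (V w) (W w)) z :=
  (((pairing δ hδ hreal).differentiableAt).comp z hV).clm_apply hW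

/-- Pairings of holomorphic vector families are holomorphic (on a set). [folklore] -/
theorem _root_.DifferentiableOn.kernelPairing {V W : ℂ → H} {s : Set ℂ} (hV : DifferentiableOn ℂ V s)
    (hW : DifferentiableOn ℂ W s) :
    DifferentiableOn ℂ (fun w => pairing δ hδ hreal (V w) (W w)) s :=
  (((pairing δ hδ hreal).differentiable).comp_differentiableOn hV).clm_apply hW

end Pairing

end KernelVectors

end Literature.Analysis.OperatorTheory
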